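import Literature.AlgebraicGeometry.HodgeTheory.ArapuraSurfaceFibredFourfoldsProofs
import Literature.AlgebraicGeometry.HodgeTheory.ComplexConjugationHolds
import Literature.AlgebraicGeometry.HodgeTheory.TopDegreeClasses
import Literature.AlgebraicGeometry.Motives.ComplexPointsEhresmann
import Literature.AlgebraicGeometry.Resolution.ResolutionOfSingularities
import Literature.AlgebraicTopology.SingularHomology.LocalDegreeSign
import HarnessLib

/-!
# Birational morphisms of smooth projective complex varieties have degree one; algebraicity descends

Topic `Literature/AlgebraicGeometry/HodgeTheory` (requested by route
`HodgeConjecture/NoetherLefschetzOneUp`, item `NetReduction`: "`σ_* σ^* = id` on `H⁴(X)`,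
`σ^*` preserves rational Hodge classes, `σ_*` preserves algebraic classes" for the blow-down `σ`
of a surface net; equally the "`σ_* 1` is a NONZERO scalar" clause of `CurveNetExists` of route
`HodgeConjecture/CurveNetMordellWeil`). Everything here is PROVED; no definition, no named fact.

W. Fulton, *Intersection Theory* (1998), Lemma 19.1.2: "Let `f : V → W` be a proper, surjective
morphism of varieties. Then `f_* cl(V) = deg(V/W) · cl(W)`", with `deg(V/W) = [R(V) : R(W)] = 1`
for `f` birational (§1.4); A. Hatcher, *Algebraic Topology* (2002), §3.3 Thm. 3.26 (fundamental
classes of closed `R`-oriented manifolds; `Hₙ(M; R) → Hₙ(M | x; R)` injective for `M` connected)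
and p. 231 (`Hₙ(U | x) ≅ Hₙ(M | x)` for `U ⊆ M` open, excision). On the tree's carriers
(`Literature.AlgebraicTopology.SingularHomology.HasDegree μ ν f d : f_* [X]_μ = d • [Y]_ν`,
`HomologicalOrientation`, `localHomology`; complex points `Motives.ComplexPoints X = X(ℂ)` with
the `2n`-manifold structure `IsSmoothProjective.chartedSpace`):

* `exists_units_smul_eq_of_iso` — an isomorphism of `R`-lines sends a generator to a UNIT multiple
  of any generator of the target (algebra);
* `isIso_localHomology_map_of_isOpenEmbedding_comp` — if `f : X → Y` composed with an open
  embedding `j : W → X` is an open embedding, then `f_* : Hₖ(X | j w) ⟶ Hₖ(Y | f (j w))` is an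
  isomorphism (local homology is local: both `j_*` and `(f ∘ j)_*` are isomorphisms by excision,
  the tree's `localHomology.isIso_map_of_isOpenEmbedding_of_eq`);
* `exists_hasDegree_one_of_isIso_localHomology_map` — **degree one from one good fibre**: a map
  `f` of closed manifolds, `Y` connected, which is a map of pairs `(X, X ∖ a) → (Y, Y ∖ b)` (i.e.
  `f⁻¹(b) ⊆ {a}`) inducing an ISOMORPHISM `Hₙ(X | a; R) ≅ Hₙ(Y | b; R)`, has degree `1` for the
  given orientation `μ` of `X` and a suitable orientation `ν'` of `Y` (namely `u • ν` for the unit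
  `u` with `f_* μₐ = u • ν_b`): `f_*[X]` and `[Y]_{ν'}` both restrict to `u • ν_b` at `b`
  (naturality of `Hₙ(–) → Hₙ(– | ·)`, Thm. 3.26(a)), and restriction at `b` is injective
  (Thm. 3.26(b)) — the argument of the tree's `ConnectedSumNeck.hasDegree_collapseLeft`, freed
  from the sign bookkeeping by letting the target orientation absorb the unit;
  `exists_hasDegree_one_of_isOpenEmbedding_comp` combines the two;
* **`exists_hasDegree_one_of_isBirational`** — for `σ : X' ⟶ X` a BIRATIONAL `ℂ`-morphism
  (`Resolution.IsBirational`: an isomorphism over a dense open `U ⊆ X` with dense preimage) of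
  smooth projective `n`-folds, there are `ℂ`-orientations `μ` of `X'(ℂ)` and `ν` of `X(ℂ)` with
  `HasDegree μ ν σ(ℂ) 1`, i.e. `σ(ℂ)_* [X'(ℂ)] = [X(ℂ)]` (Fulton's Lemma 19.1.2 for `deg = 1`,
  in singular homology of the compact manifolds): `σ(ℂ)` restricted to the open `σ⁻¹U(ℂ)` is the
  open embedding `σ⁻¹U(ℂ) ≅ U(ℂ) ↪ X(ℂ)` (`AlgPoints.isOpenEmbedding_map_holds`), a complex point
  of `σ⁻¹U` exists (`ComplexPoints.exists_pt_mem`, Nullstellensatz) and is the whole fibre of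
  `σ(ℂ)` through it, and `X(ℂ)` is a closed connected `2n`-manifold
  (`connectedSpace_complexPoints`, SGA1 XII Prop. 2.4);
* **`mem_algebraicClasses_of_isBirational`**, `hodgeClasses_algebraic_of_isBirational`,
  `HodgeConjectureFor.of_isBirational` — **algebraicity of rational `(p,p)`-classes descends
  along birational morphisms** of smooth projective complex varieties (e.g. from a blow-up to its
  base): the tree's descent along maps of non-zero degree
  (`mem_algebraicClasses_of_map_mem_of_hasDegree`, projection formula `σ_!(σ^* c) = c` and
  `σ_!` preserves algebraic classes) fed with degree `1` and with the Hodge model of `X'`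
  (`nonempty_hodgeModel_holds`, for the Hodge type of `σ^* c`).

## What is deliberately NOT here

The value of the degree for the COMPLEX orientations of both sides (it is `1`; here the target
orientation is chosen), degrees of generically finite morphisms (`deg(V/W) > 1`: a sum of local
degrees over a general fibre), and Borel–Moore homology of non-compact varieties (Fulton's
setting); only the closed-manifold case needed by the Hodge-conjecture routes is treated.

## References

* W. Fulton, *Intersection Theory*, 2nd ed., Springer (1998), §1.4 (p. 11, `f_*[V] = deg(V/W)[W]`)
  and Lemma 19.1.2 (p. 371). [Fulton1998]
* A. Hatcher, *Algebraic Topology*, CUP (2002), §3.3 p. 231, Thm. 3.26, Exercise 8 (degree for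
  maps of closed oriented manifolds). [HatcherAT2002]
* A. Grothendieck, M. Raynaud, *SGA 1*, Exp. XII, Prop. 2.4 and Prop. 3.1. [SGA1]
* C. Voisin, *Hodge Theory and Complex Algebraic Geometry I* (2002), §7.3.2 (pull-back is a
  morphism of Hodge structures), Lemma 7.28. [VoisinHodgeI2002]
-/

noncomputable section

open CategoryTheory Set Topology AlgebraicGeometry
open Literature.AlgebraicTopology.SingularHomology

universe u v

namespace Literature.AlgebraicGeometry.HodgeTheory

/-! ### Generators of `R`-lines under isomorphisms -/

section Generators

variable {R : Type v} [CommRing R]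

/-- **An isomorphism of `R`-lines sends a generator to a unit multiple of a generator.** If
`φ : N ≅ N'` is an isomorphism of `R`-modules, `a ∈ N` corresponds to `1` under some
`N ≃ₗ[R] R` and `b ∈ N'` to `1` under some `N' ≃ₗ[R] R`, then `φ a = u • b` for a unit `u ∈ Rˣ`
(`φ a = c • b` with `c` the coordinate of `φ a`, and `c` is a unit because `φ a` is again a
generator). [folklore] -/
theorem exists_units_smul_eq_of_iso {N N' : ModuleCat.{max u v} R} (φ : N ≅ N') {a : N} {b : N'}
    (ha : ∃ e : N ≃ₗ[R] R, e a = 1) (hb : ∃ e : N' ≃ₗ[R] R, e b = 1) :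
    ∃ u : Rˣ, φ.hom a = (u : R) • b := by
  obtain ⟨e, he⟩ := ha
  obtain ⟨e', he'⟩ := hb
  set c : R := e' (φ.hom a) with hc
  have hca : φ.hom a = c • b := by
    apply e'.injective
    rw [map_smul, he', smul_eq_mul, mul_one]
  let e'' : N' ≃ₗ[R] R := φ.symm.toLinearEquiv.trans e
  have h1 : e'' (φ.hom a) = 1 := by
    change e (φ.inv (φ.hom a)) = 1
    rw [← ModuleCat.comp_apply, Iso.hom_inv_id, ModuleCat.id_apply, he]
  have hunit : IsUnit c := by
    rw [hca, map_smul, smul_eq_mul] at h1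
    exact IsUnit.of_mul_eq_one (e'' b) h1
  exact ⟨hunit.unit, by rw [hunit.unit_spec]; exact hca⟩

end Generators

/-! ### Local homology is local: maps that restrict to an open embedding -/

section LocalIso

variable (R : Type v) [CommRing R] (M : Type v) [AddCommGroup M] [Module R M]
variable {W X Y : Type u} [TopologicalSpace W] [TopologicalSpace X] [TopologicalSpace Y]

/-- **Push-forward of local homology along a map that is an open embedding near the point is an
isomorphism.** If `j : W → X` is an open embedding and `f ∘ j : W → Y` is an open embedding, then
for every `w` and every `b = f (j w)` with `f⁻¹(b) ⊆ {j w}` (the map-of-pairs condition `hfib`),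
`f_* : Hₖ(X | j w; M) ⟶ Hₖ(Y | b; M)` is an isomorphism: `(f ∘ j)_* = f_* ∘ j_*` with `j_*` and
`(f ∘ j)_*` isomorphisms (Hatcher 2002, §3.3 p. 231, excision; the tree's
`localHomology.isIso_map_of_isOpenEmbedding_of_eq`). [cite: HatcherAT2002, §3.3 p. 231] -/
theorem isIso_localHomology_map_of_isOpenEmbedding_comp [T1Space X] [T1Space Y] (f : C(X, Y))
    (j : C(W, X)) (hj : IsOpenEmbedding j) (hfj : IsOpenEmbedding (f.comp j)) (w : W) {b : Y}
    (hb : f (j w) = b) (hfib : MapsTo f {j w}ᶜ {b}ᶜ) (k : ℕ) :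
    IsIso (relativeSingularHomology.map R M f hfib k) := by
  haveI h1 := localHomology.isIso_map_of_isOpenEmbedding_of_eq R M j hj w rfl k
  haveI h2 := localHomology.isIso_map_of_isOpenEmbedding_of_eq R M (f.comp j) hfj w hb k
  have hcomp : relativeSingularHomology.map R M (f.comp j)
        (hfib.comp (mapsTo_compl_singleton_of_injective hj.injective rfl)) k =
      relativeSingularHomology.map R M j (mapsTo_compl_singleton_of_injective hj.injective rfl) k ≫
        relativeSingularHomology.map R M f hfib k :=
    relativeSingularHomology.map_comp R M j f _ hfib k
  have h3 : IsIso (relativeSingularHomology.map R M j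
      (mapsTo_compl_singleton_of_injective hj.injective rfl) k ≫
        relativeSingularHomology.map R M f hfib k) := by
    rw [← hcomp]
    exact h2
  exact IsIso.of_isIso_comp_left
    (relativeSingularHomology.map R M j (mapsTo_compl_singleton_of_injective hj.injective rfl) k) _

end LocalIso

/-! ### Degree one from one good fibre -/

section Degree

variable {R : Type v} [CommRing R] {n : ℕ}
variable {X Y : Type u} [TopologicalSpace X] [TopologicalSpace Y]
  [CompactSpace X] [T2Space X] [ChartedSpace (EuclideanSpace ℝ (Fin n)) X]
  [CompactSpace Y] [T2Space Y] [ChartedSpace (EuclideanSpace ℝ (Fin n)) Y] [ConnectedSpace Y]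

/-- **Degree one from an isomorphism of local homology at one fibre.** Let `f : X → Y` be a map of
closed topological `n`-manifolds, `Y` connected, `μ` an `R`-orientation of `X` and `ν` one of `Y`,
and let `a ∈ X`, `b ∈ Y` with `f (X ∖ a) ⊆ Y ∖ b` such that `f_* : Hₙ(X | a; R) ⟶ Hₙ(Y | b; R)`
is an isomorphism. Then `f` has degree `1` (`f_* [X]_μ = [Y]_{ν'}`) for the orientation
`ν' = u • ν` of `Y`, `u ∈ Rˣ` the unit with `f_* μₐ = u • ν_b` (`exists_units_smul_eq_of_iso`):
both `f_* [X]_μ` and `[Y]_{ν'}` restrict to `u • ν_b` in `Hₙ(Y | b; R)` (naturality of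
`Hₙ(–) → Hₙ(– | ·)` and Hatcher Thm. 3.26(a), the tree's
`isFundamentalClass_fundamentalClass_holds`), and `Hₙ(Y; R) → Hₙ(Y | b; R)` is injective for `Y`
closed connected (Hatcher Thm. 3.26(b), the tree's `toLocal_injective_of_connectedSpace_holds`).
[cite: HatcherAT2002, §3.3 Thm. 3.26 and Exercise 8] -/
theorem exists_hasDegree_one_of_isIso_localHomology_map (f : C(X, Y)) {a : X} {b : Y}
    (hfib : MapsTo f {a}ᶜ {b}ᶜ) (hiso : IsIso (relativeSingularHomology.map R R f hfib n))
    (μ : HomologicalOrientation R X n) (ν : HomologicalOrientation R Y n) :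
    ∃ ν' : HomologicalOrientation R Y n, HasDegree μ ν' f 1 := by
  obtain ⟨u, hu⟩ := exists_units_smul_eq_of_iso (asIso (relativeSingularHomology.map R R f hfib n))
    (μ.isGenerator a) (ν.isGenerator b)
  -- the rescaled orientation `u • ν` of `Y`
  let ν' : HomologicalOrientation R Y n :=
    { localClass := fun y ↦ (u : R) • ν.localClass y
      isGenerator := fun y ↦ by
        obtain ⟨e, he⟩ := ν.isGenerator y
        refine ⟨e.trans (LinearEquiv.smulOfUnit u⁻¹), ?_⟩
        rw [LinearEquiv.trans_apply, map_smul, he]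
        change ((u⁻¹ : Rˣ) : R) • ((u : R) • (1 : R)) = 1
        rw [smul_eq_mul, smul_eq_mul, mul_one, Units.inv_mul]
      locallyConsistent := fun y ↦ by
        obtain ⟨K, hK, μK, hμK⟩ := ν.locallyConsistent y
        exact ⟨K, hK, (u : R) • μK, fun z hz ↦ by rw [map_smul, hμK z hz]⟩ }
  refine ⟨ν', ?_⟩
  rw [HasDegree, one_zsmul]
  apply singularHomology.toLocal_injective_of_connectedSpace_holds R R Y n b
  have hnat := relativeSingularHomology.ofAbsolute_comp_map R R f hfib n
  -- `(f_* [X]) | b = f_* ([X] | a)`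
  have h1 : singularHomology.toLocal R R b n (singularHomology.map R R f n μ.fundamentalClass) =
      relativeSingularHomology.map R R f hfib n
        (singularHomology.toLocal R R a n μ.fundamentalClass) := by
    change (singularHomology.map R R f n ≫ relativeSingularHomology.ofAbsolute R R Y {b}ᶜ n)
        μ.fundamentalClass =
      (relativeSingularHomology.ofAbsolute R R X {a}ᶜ n ≫ relativeSingularHomology.map R R f hfib n)
        μ.fundamentalClass
    rw [hnat]
  rw [h1, HomologicalOrientation.isFundamentalClass_fundamentalClass_holds n μ a,
    HomologicalOrientation.isFundamentalClass_fundamentalClass_holds n ν' b]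
  exact hu

/-- **Degree one for a map that is an open embedding near a whole fibre.** If `j : W → X` and
`f ∘ j : W → Y` are open embeddings and the fibre of `f` through `j w` is `{j w}`, then `f` has
degree `1` for the given orientation of `X` and a suitable orientation of the connected closed
manifold `Y` (`isIso_localHomology_map_of_isOpenEmbedding_comp` +
`exists_hasDegree_one_of_isIso_localHomology_map`). [cite: HatcherAT2002, §3.3 Thm. 3.26 and p. 231] -/
theorem exists_hasDegree_one_of_isOpenEmbedding_comp {W : Type u} [TopologicalSpace W]
    (f : C(X, Y)) (j : C(W, X)) (hj : IsOpenEmbedding j) (hfj : IsOpenEmbedding (f.comp j))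
    (w : W) (hfib : MapsTo f {j w}ᶜ {f (j w)}ᶜ)
    (μ : HomologicalOrientation R X n) (ν : HomologicalOrientation R Y n) :
    ∃ ν' : HomologicalOrientation R Y n, HasDegree μ ν' f 1 :=
  exists_hasDegree_one_of_isIso_localHomology_map f hfib
    (isIso_localHomology_map_of_isOpenEmbedding_comp R R f j hj hfj w rfl hfib n) μ ν

end Degree

/-! ### Birational morphisms of smooth projective complex varieties -/

section HodgeTheory

open Literature.AlgebraicGeometry.Motives

variable {n : ℕ} {X' X : Motives.SchemeOver ℂ}

/-- **A birational morphism of smooth projective complex varieties has degree one** (Fulton 1998,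
Lemma 19.1.2 with `deg(X'/X) = 1`, §1.4: `σ_* cl(X') = cl(X)`; here in singular homology of the
closed `2n`-manifolds `X'(ℂ)`, `X(ℂ)`). Let `σ : X' ⟶ X` be a `ℂ`-morphism of smooth projective
`n`-folds which is birational (`Resolution.IsBirational σ.left`: an isomorphism over a dense open
`U ⊆ X` with dense preimage). Then for some `ℂ`-orientations `μ` of `X'(ℂ)` and `ν` of `X(ℂ)`
(they exist: `ComplexPoints.isOrientableOver`), `σ(ℂ)_* [X'(ℂ)]_μ = [X(ℂ)]_ν`, i.e.
`HasDegree μ ν σ(ℂ) 1`. Proof: `σ(ℂ)` composed with the open embedding `σ⁻¹U(ℂ) ↪ X'(ℂ)` is the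
open embedding `σ⁻¹U(ℂ) ≅ U(ℂ) ↪ X(ℂ)` (`AlgPoints.isOpenEmbedding_map_holds`, SGA1 XII
Prop. 3.1 (xi)); a complex point `w` of the non-empty open `σ⁻¹U` exists
(`ComplexPoints.exists_pt_mem`) and `{w}` is the whole fibre of `σ(ℂ)` through it; `X(ℂ)` is a
closed connected `2n`-manifold (`connectedSpace_complexPoints`, SGA1 XII Prop. 2.4); conclude by
`exists_hasDegree_one_of_isOpenEmbedding_comp`. [cite: Fulton1998, Lemma 19.1.2 and §1.4]
[cite: HatcherAT2002, §3.3 Thm. 3.26] -/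
theorem exists_hasDegree_one_of_isBirational (hX' : IsSmoothProjective n X')
    (hX : IsSmoothProjective n X) (σ : X' ⟶ X) (hσ : Resolution.IsBirational σ.left) :
    ∃ (μ : HomologicalOrientation ℂ (ComplexPoints X') (2 * n))
      (ν : HomologicalOrientation ℂ (ComplexPoints X) (2 * n)),
      HasDegree μ ν (AlgPoints.mapContinuous (L := ℂ) σ) 1 := by
  letI := hX.chartedSpace
  letI := hX'.chartedSpace
  haveI := ComplexPoints.compactSpace_of_isSmoothProjective hX
  haveI := ComplexPoints.compactSpace_of_isSmoothProjective hX'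
  haveI := ComplexPoints.t2Space_of_isSmoothProjective hX
  haveI := ComplexPoints.t2Space_of_isSmoothProjective hX'
  haveI := connectedSpace_complexPoints hX
  obtain ⟨μ⟩ := ComplexPoints.isOrientableOver ℂ hX'
  obtain ⟨ν⟩ := ComplexPoints.isOrientableOver ℂ hX
  obtain ⟨U, -, hU', hiso⟩ := hσ
  -- instances on the schemes
  haveI : IsProper X'.hom := IsSmoothProjective.isProper_holds hX'
  haveI : IsProper X.hom := IsSmoothProjective.isProper_holds hX
  haveI := hX'.geometricallyIrreducible
  haveI : IrreducibleSpace X'.left := GeometricallyIrreducible.irreducibleSpace_of_subsingleton X'.hom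
  -- the open pieces `V = σ⁻¹U ⊆ X'` and `U ⊆ X` as `ℂ`-schemes; `σ ∘ (V ↪ X') = (V ≅ U ↪ X)`
  set V : X'.left.Opens := σ.left ⁻¹ᵁ U with hV
  set j : openSubschemeOver X' V ⟶ X' := openSubschemeOverι X' V with hj
  set g : openSubschemeOver X' V ⟶ X := restrictOverHom σ U ≫ openSubschemeOverι X U with hg
  haveI : IsOpenImmersion j.left := inferInstanceAs (IsOpenImmersion V.ι)
  haveI : IsIso (σ.left ∣_ U) := hiso
  haveI : IsOpenImmersion (σ.left ∣_ U) := inferInstance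
  haveI : IsOpenImmersion g.left := by
    change IsOpenImmersion ((σ.left ∣_ U) ≫ U.ι)
    infer_instance
  have hjg : j ≫ σ = g := (restrictOverHom_comp_openSubschemeOverι σ U).symm
  have hje : IsOpenEmbedding (AlgPoints.mapContinuous (L := ℂ) j) :=
    AlgPoints.isOpenEmbedding_map_holds j
  have hcomp : (AlgPoints.mapContinuous (L := ℂ) σ).comp (AlgPoints.mapContinuous (L := ℂ) j) =
      AlgPoints.mapContinuous (L := ℂ) g := by
    ext1 P
    change AlgPoints.map σ (AlgPoints.map j P) = AlgPoints.map g P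
    rw [← AlgPoints.map_comp_apply, hjg]
  have hge : IsOpenEmbedding
      ((AlgPoints.mapContinuous (L := ℂ) σ).comp (AlgPoints.mapContinuous (L := ℂ) j)) := by
    rw [hcomp]
    exact AlgPoints.isOpenEmbedding_map_holds g
  -- a complex point `w` of `V`
  have hVne : ((V : Set X'.left)).Nonempty := hU'.nonempty
  obtain ⟨P, hP⟩ := ComplexPoints.exists_pt_mem hVne V.2.isLocallyClosed
  obtain ⟨w, hw⟩ : P ∈ Set.range (AlgPoints.map j : ComplexPoints (openSubschemeOver X' V) →
      ComplexPoints X') := by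
    rw [AlgPoints.range_map_of_isOpenImmersion_holds j]
    change P.pt ∈ V.ι.opensRange
    rwa [Scheme.Opens.opensRange_ι]
  -- the fibre of `σ(ℂ)` through `j w` is `{j w}`
  have hwV : (AlgPoints.map j w).pt ∈ V := by
    rw [AlgPoints.pt_map]
    change V.ι.base w.pt ∈ (V : Set X'.left)
    rw [← Scheme.Opens.range_ι]
    exact Set.mem_range_self _
  have hfib : MapsTo (AlgPoints.mapContinuous (L := ℂ) σ) {AlgPoints.mapContinuous (L := ℂ) j w}ᶜ
      {AlgPoints.mapContinuous (L := ℂ) σ (AlgPoints.mapContinuous (L := ℂ) j w)}ᶜ := by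
    intro Q hQ hQ'
    apply hQ
    rw [Set.mem_singleton_iff] at hQ' ⊢
    change AlgPoints.map σ Q = AlgPoints.map σ (AlgPoints.map j w) at hQ'
    change Q = AlgPoints.map j w
    have hQV : Q.pt ∈ V := by
      have h := congrArg AlgPoints.pt hQ'
      rw [AlgPoints.pt_map, AlgPoints.pt_map] at h
      change σ.left.base Q.pt ∈ U
      rw [h]
      exact hwV
    obtain ⟨w', rfl⟩ : Q ∈ Set.range (AlgPoints.map j : ComplexPoints (openSubschemeOver X' V) →
        ComplexPoints X') := by
      rw [AlgPoints.range_map_of_isOpenImmersion_holds j]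
      change Q.pt ∈ V.ι.opensRange
      rwa [Scheme.Opens.opensRange_ι]
    exact congrArg (AlgPoints.map j) (hge.injective hQ')
  obtain ⟨ν', h⟩ := exists_hasDegree_one_of_isOpenEmbedding_comp (R := ℂ)
    (AlgPoints.mapContinuous (L := ℂ) σ) (AlgPoints.mapContinuous (L := ℂ) j) hje hge w hfib μ ν
  exact ⟨μ, ν', h⟩

/-- **Algebraicity of a rational `(p,p)`-class descends along a birational morphism.** Let
`σ : X' ⟶ X` be a birational `ℂ`-morphism of smooth projective `n`-folds (e.g. a blow-up along a
smooth centre) and suppose every rational `(p,p)`-class of `X'` is algebraic. Then every rational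
class `c ∈ H²ᵖ(X(ℂ); ℂ)` of Hodge type `(p,p)` is algebraic on `X`: `σ^* c` is rational
(`IsRationalClass.map`) and of type `(p,p)` (`IsOfHodgeType.map_of_le`, Voisin I §7.3.2, with the
Hodge model of `X'` of `nonempty_hodgeModel_holds`), hence algebraic, and algebraicity descends
along `σ`, of degree `1` (`exists_hasDegree_one_of_isBirational`), by the projection formula
`σ_!(σ^* c) = c` and `σ_!(Nᵖ) ⊆ Nᵖ` (the tree's `mem_algebraicClasses_of_map_mem_of_hasDegree`,
Fulton 1998 Lemma 19.1.2 / Voisin II Prop. 9.21 (ii)). [cite: Fulton1998, Lemma 19.1.2]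
[cite: VoisinHodgeI2002, §7.3.2] -/
theorem mem_algebraicClasses_of_isBirational (hX' : IsSmoothProjective n X')
    (hX : IsSmoothProjective n X) (σ : X' ⟶ X) (hσ : Resolution.IsBirational σ.left) {p : ℕ}
    (h' : ∀ c' : complexBetti X' (2 * p), IsRationalClass c' →
      IsOfHodgeType n X' (2 * p) p p c' → c' ∈ algebraicClasses X' p)
    (c : complexBetti X (2 * p)) (hc : IsRationalClass c) (hpp : IsOfHodgeType n X (2 * p) p p c) :
    c ∈ algebraicClasses X p := by
  obtain ⟨μ, ν, hμν⟩ := exists_hasDegree_one_of_isBirational hX' hX σ hσ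
  obtain ⟨B⟩ := nonempty_hodgeModel_holds (n := n) (X := X') hX'
  exact mem_algebraicClasses_of_map_mem_of_hasDegree hX' hX σ μ ν one_ne_zero hμν
    (h' _ (hc.map (AlgPoints.mapContinuous (L := ℂ) σ)) (hpp.map_of_le hX' hX B σ le_rfl))

/-- **The cycle part of the Hodge conjecture descends along birational morphisms**: if every
rational `(p,p)`-class of `X'` is algebraic for every `p`, and `σ : X' ⟶ X` is a birational
morphism of smooth projective complex `n`-folds, then every rational `(p,p)`-class of `X` is
algebraic for every `p` (`mem_algebraicClasses_of_isBirational` degree by degree).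
[cite: Fulton1998, Lemma 19.1.2] [cite: VoisinHodgeI2002, §7.3.2] -/
theorem hodgeClasses_algebraic_of_isBirational (hX' : IsSmoothProjective n X')
    (hX : IsSmoothProjective n X) (σ : X' ⟶ X) (hσ : Resolution.IsBirational σ.left)
    (h' : ∀ (p : ℕ) (c' : complexBetti X' (2 * p)), IsRationalClass c' →
      IsOfHodgeType n X' (2 * p) p p c' → c' ∈ algebraicClasses X' p)
    (p : ℕ) (c : complexBetti X (2 * p)) (hc : IsRationalClass c)
    (hpp : IsOfHodgeType n X (2 * p) p p c) : c ∈ algebraicClasses X p :=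
  mem_algebraicClasses_of_isBirational hX' hX σ hσ (h' p) c hc hpp

/-- **The Hodge conjecture descends along birational morphisms** (summit spelling):
`HodgeConjectureFor n X'` and a birational `σ : X' ⟶ X` of smooth projective `n`-folds give
`HodgeConjectureFor n X` (the Hodge model of `X` is `nonempty_hodgeModel_holds`). In particular
the Hodge conjecture for a blow-up `Bl_Z X` implies it for `X`. [cite: Fulton1998, Lemma 19.1.2]
[cite: Deligne2000, §1] -/
theorem HodgeConjectureFor.of_isBirational (h : HodgeConjectureFor n X')
    (hX' : IsSmoothProjective n X') (hX : IsSmoothProjective n X) (σ : X' ⟶ X)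
    (hσ : Resolution.IsBirational σ.left) : HodgeConjectureFor n X :=
  ⟨nonempty_hodgeModel_holds (n := n) (X := X) hX,
    hodgeClasses_algebraic_of_isBirational hX' hX σ hσ h.2⟩

end HodgeTheory

end Literature.AlgebraicGeometry.HodgeTheory

end
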